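import Literature.Analysis.ODE.PlanarFlowEscape
import Literature.Topology.FourManifolds.UnitBallDiffeotopyReduction
import Mathlib.Analysis.SpecialFunctions.ExpDeriv
import HarnessLib

/-!
# Smale's straightening isotopy for unit vector fields standard off the unit disc

Topic `Literature/Topology/FourManifolds` (the analytic core of S. Smale, *Diffeomorphisms of the
2-sphere*, Proc. AMS 10 (1959), proof of Thm. B, in the plane `ℂ`; J. Cerf, LNM 53 (1968),
Appendice §5, Théorème 4 "le théorème de Smale"). Smale deforms a diffeomorphism of the square
through the nowhere-vanishing vector fields `e^{iτθ}` interpolating between the constant field and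
the image of the horizontal field, re-integrating each field from the left edge. This file
carries out the re-integration:

* **One field.** For a `C¹` field `X` on `ℂ` with `‖X‖ ≤ 1`, equal to `1` off the closed unit
  disc: flow lines are straight off the disc (`globalFlow_eq_add_of_forall_one_le_norm`), the
  real part moves at speed `≤ 1` (`abs_re_globalFlow_sub_re_le`), the time-`t` map has invertible
  derivative transporting `X` (`exists_clEquiv_fderiv_globalFlow`, `fderiv_globalFlow_apply_self`),
  and the **straightening map** `z ↦ Φ_{Re z + 2} (-2 + i Im z)` (flow for time `Re z + 2` from the
  point of the line `Re = -2` at height `Im z`) is injective, has derivative `DΦ_t` at the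
  corresponding point (`hasFDerivAt_flowStraighten`), and is onto as soon as backward semi-orbits are
  unbounded (`surjective_flowStraighten`) — which `Literature.Analysis.ODE.exists_lt_norm_globalFlow_of_nonpos`
  (`PlanarFlowEscape.lean`) guarantees for fields with a global logarithm.
* **The family.** Given `Θ : ℂ → ℂ` smooth, purely imaginary, vanishing off the unit disc (the
  angle function `iθ`), the fields `X_τ = exp (χ(τ) Θ)` (`χ` = `Real.smoothTransition`) all
  qualify, and the straightening maps assemble into an **ambient isotopy** of `ℂ`
  (`exists_ambientIsotopy_flowStraighten`: `Literature.Topology.FourManifolds.AmbientIsotopy`, joint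
  smoothness through the flow of the suspended field `(X_τ, 0)` on `ℂ × ℝ`), starting at the
  identity (`X_0 = 1`), equal to the identity on `{|Im z| ≥ 1}` and on `{Re z ≤ -1}`, translation
  equivariant far right, non-increasing on real parts, with `∂/∂x = 1` wherever the image is off
  the disc, and whose final stage carries the lines `Im = c` to the level sets of any first
  integral of `X_1 = exp Θ` that equals `Im` off the disc.

Everything here is proved; there are no definitions and no named facts (the isotopy is produced
existentially with its list of properties, consumed by `SmaleDiffDisc.lean`).

## References

* S. Smale, *Diffeomorphisms of the 2-sphere*, Proc. Amer. Math. Soc. 10 (1959) 621–626, Thm. B.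
* J. Cerf, *Sur les difféomorphismes de la sphère de dimension trois (Γ₄ = 0)*, LNM 53 (1968),
  Appendice §5, Théorème 4. [CerfDiffeoSphere1968]
* P. Hartman, *Ordinary Differential Equations* (SIAM 2002), Ch. V §3 (differentiability of
  flows; `DΦ_t X = X ∘ Φ_t`). [Hartman2002]
-/

noncomputable section

open Complex Set Filter Function Metric Topology
open scoped Real NNReal Manifold ContDiff
open Literature.Analysis.ODE Literature.Topology.PlaneTopology

namespace Literature.Topology.FourManifolds

/-! ### One field: straight flow lines off the disc, speed of the real part -/

section OneField

variable {X : ℂ → ℂ} {K : ℝ≥0}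

/-- **Flow lines are straight where the field is `1`.** If the horizontal segment
`z + [0, T]` lies in `{‖·‖ ≥ 1}`, where `X = 1`, then `Φ_T z = z + T`. [folklore] -/
theorem globalFlow_eq_add_of_forall_one_le_norm (hK : LipschitzWith K X) (hB : ∀ z, ‖X z‖ ≤ 1)
    (hout : ∀ z, 1 ≤ ‖z‖ → X z = 1) {z : ℂ} {T : ℝ} (hT : 0 ≤ T)
    (hseg : ∀ σ ∈ Icc 0 T, 1 ≤ ‖z + σ‖) : globalFlow hK hB z T = z + T := by
  have key := ODE_solution_unique (v := fun _ => X) (K := K) (fun _ => hK)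
    (f := fun t => globalFlow hK hB z t) (g := fun t : ℝ => z + t) (a := 0) (b := T)
    (continuous_globalFlow hK hB z).continuousOn
    (fun t _ => (hasDerivAt_globalFlow hK hB z t).hasDerivWithinAt)
    (by fun_prop) (fun t ht => by
      have h1 : HasDerivAt (fun t : ℝ => z + t) 1 t := by
        simpa using ((hasDerivAt_id t).ofReal_comp).const_add z
      show HasDerivWithinAt (fun t : ℝ => z + t) (X (z + t)) (Ici t) t
      rw [hout _ (hseg t ⟨ht.1, ht.2.le⟩)]
      exact h1.hasDerivWithinAt) (by simp)
  exact key ⟨hT, le_rfl⟩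

/-- The same backward in time: if `z + [T, 0]` lies in `{‖·‖ ≥ 1}` (`T ≤ 0`) then
`Φ_T z = z + T`. [folklore] -/
theorem globalFlow_eq_add_of_forall_one_le_norm' (hK : LipschitzWith K X) (hB : ∀ z, ‖X z‖ ≤ 1)
    (hout : ∀ z, 1 ≤ ‖z‖ → X z = 1) {z : ℂ} {T : ℝ} (hT : T ≤ 0)
    (hseg : ∀ σ ∈ Icc T 0, 1 ≤ ‖z + σ‖) : globalFlow hK hB z T = z + T := by
  have h1 : globalFlow hK hB (z + T) (-T) = z + T + ((-T : ℝ) : ℂ) := by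
    refine globalFlow_eq_add_of_forall_one_le_norm hK hB hout (by linarith) fun σ hσ => ?_
    have := hseg (T + σ) ⟨by linarith [hσ.1], by linarith [hσ.2]⟩
    push_cast at this ⊢
    rwa [add_assoc]
  have h2 : globalFlow hK hB (z + T) (-T) = z := by rw [h1]; push_cast; ring
  calc globalFlow hK hB z T = globalFlow hK hB (globalFlow hK hB (z + T) (-T)) T := by rw [h2]
    _ = z + T := by rw [← globalFlow_add, neg_add_cancel, globalFlow_zero]

/-- **The real part moves at speed at most one** (`‖X‖ ≤ 1`): `|Re Φ_T z - Re z| ≤ |T|`.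
[folklore] -/
theorem abs_re_globalFlow_sub_re_le (hK : LipschitzWith K X) (hB : ∀ z, ‖X z‖ ≤ 1) (z : ℂ) (T : ℝ) :
    |(globalFlow hK hB z T).re - z.re| ≤ |T| := by
  have key := (convex_univ (𝕜 := ℝ) (E := ℝ)).norm_image_sub_le_of_norm_hasDerivWithin_le
    (f := fun t => globalFlow hK hB z t) (f' := fun t => X (globalFlow hK hB z t)) (C := 1)
    (fun t _ => (hasDerivAt_globalFlow hK hB z t).hasDerivWithinAt) (fun t _ => hB _)
    (mem_univ 0) (mem_univ T)
  rw [globalFlow_zero, one_mul, sub_zero, Real.norm_eq_abs] at key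
  have := abs_re_le_norm (globalFlow hK hB z T - z)
  rw [sub_re] at this
  exact this.trans key

/-! ### One field: the derivative of the time-`t` map -/

/-- The time-`t` map of the flow of a `C¹` field is differentiable. [folklore] -/
theorem hasFDerivAt_globalFlow_apply (hX : ContDiff ℝ 1 X) (hK : LipschitzWith K X)
    (hB : ∀ z, ‖X z‖ ≤ 1) (t : ℝ) (p : ℂ) :
    HasFDerivAt (fun p : ℂ => globalFlow hK hB p t) (fderiv ℝ (fun p : ℂ => globalFlow hK hB p t) p) p := by
  have h : ContDiff ℝ 1 fun p : ℂ => globalFlow hK hB p t :=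
    (contDiff_globalFlow hX le_rfl hK hB).comp (contDiff_id.prodMk contDiff_const)
  exact (h.differentiable (by simp) p).hasFDerivAt

/-- **The derivative of the time-`t` map is invertible** (its inverse is the derivative of the
time-`(-t)` map at the image point). [folklore] -/
theorem exists_clEquiv_fderiv_globalFlow (hX : ContDiff ℝ 1 X) (hK : LipschitzWith K X)
    (hB : ∀ z, ‖X z‖ ≤ 1) (t : ℝ) (p : ℂ) :
    ∃ M : ℂ ≃L[ℝ] ℂ, (M : ℂ →L[ℝ] ℂ) = fderiv ℝ (fun p : ℂ => globalFlow hK hB p t) p := by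
  set A := fderiv ℝ (fun p : ℂ => globalFlow hK hB p t) p with hA
  set A' := fderiv ℝ (fun q : ℂ => globalFlow hK hB q (-t)) (globalFlow hK hB p t) with hA'
  have h1 : HasFDerivAt (fun p : ℂ => globalFlow hK hB p t) A p := hasFDerivAt_globalFlow_apply hX hK hB t p
  have h2 : HasFDerivAt (fun q : ℂ => globalFlow hK hB q (-t)) A' (globalFlow hK hB p t) :=
    hasFDerivAt_globalFlow_apply hX hK hB (-t) _
  -- `Φ_{-t} ∘ Φ_t = id`
  have hcomp1 : A'.comp A = ContinuousLinearMap.id ℝ ℂ := by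
    have h3 := h2.comp p h1
    have h4 : ((fun q : ℂ => globalFlow hK hB q (-t)) ∘ fun p : ℂ => globalFlow hK hB p t) = id := by
      funext q; exact globalFlow_neg_globalFlow hK hB q t
    rw [h4] at h3
    exact h3.unique (hasFDerivAt_id p)
  -- `Φ_t ∘ Φ_{-t} = id` at the image point
  have hcomp2 : A.comp A' = ContinuousLinearMap.id ℝ ℂ := by
    have h5 : HasFDerivAt (fun p : ℂ => globalFlow hK hB p t) A
        (globalFlow hK hB (globalFlow hK hB p t) (-t)) := by
      rw [globalFlow_neg_globalFlow]; exact h1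
    have h3 := h5.comp (globalFlow hK hB p t) h2
    have h4 : ((fun p : ℂ => globalFlow hK hB p t) ∘ fun q : ℂ => globalFlow hK hB q (-t)) = id := by
      funext q
      have := globalFlow_neg_globalFlow hK hB q (-t)
      rwa [neg_neg] at this
    rw [h4] at h3
    exact h3.unique (hasFDerivAt_id _)
  refine ⟨ContinuousLinearEquiv.equivOfInverse A A' (fun v => ?_) (fun v => ?_), rfl⟩
  · have := congrArg (fun f : ℂ →L[ℝ] ℂ => f v) hcomp1
    simpa using this
  · have := congrArg (fun f : ℂ →L[ℝ] ℂ => f v) hcomp2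
    simpa using this

/-- **The flow transports the field**: `DΦ_t(p) (X p) = X (Φ_t p)` (differentiate
`Φ_t (Φ_s p) = Φ_{t+s} p` at `s = 0`). [cite: Hartman2002, Ch. V §3] -/
theorem fderiv_globalFlow_apply_self (hX : ContDiff ℝ 1 X) (hK : LipschitzWith K X)
    (hB : ∀ z, ‖X z‖ ≤ 1) (t : ℝ) (p : ℂ) :
    fderiv ℝ (fun p : ℂ => globalFlow hK hB p t) p (X p) = X (globalFlow hK hB p t) := by
  have h1 := hasFDerivAt_globalFlow_apply hX hK hB t p
  -- `s ↦ Φ_t (Φ_s p)` has derivative `DΦ_t (X p)` at `0`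
  have h2 : HasDerivAt (fun s : ℝ => globalFlow hK hB p s) (X p) 0 := by
    simpa using hasDerivAt_globalFlow hK hB p 0
  have h1' : HasFDerivAt (fun q : ℂ => globalFlow hK hB q t) (fderiv ℝ (fun p : ℂ => globalFlow hK hB p t) p)
      (globalFlow hK hB p 0) := by
    rw [globalFlow_zero]; exact h1
  have h3 : HasDerivAt ((fun q : ℂ => globalFlow hK hB q t) ∘ fun s : ℝ => globalFlow hK hB p s)
      (fderiv ℝ (fun p : ℂ => globalFlow hK hB p t) p (X p)) 0 :=
    h1'.comp_hasDerivAt (0 : ℝ) h2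
  -- and equals `s ↦ Φ_{s + t} p`, with derivative `X (Φ_t p)`
  have h4 : ((fun q : ℂ => globalFlow hK hB q t) ∘ fun s : ℝ => globalFlow hK hB p s) =
      fun s : ℝ => globalFlow hK hB p (s + t) := by
    funext s; exact (globalFlow_add hK hB p s t).symm
  have h5 : HasDerivAt (fun s : ℝ => globalFlow hK hB p (s + t)) (X (globalFlow hK hB p t)) 0 := by
    have h6 : HasDerivAt (fun s : ℝ => s + t) 1 0 := (hasDerivAt_id' (0 : ℝ)).add_const t
    have := (hasDerivAt_globalFlow hK hB p (0 + t)).scomp (0 : ℝ) h6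
    simp only [zero_add, one_smul] at this
    exact this
  rw [h4] at h3
  exact h3.unique h5

end OneField

/-! ### One field: the straightening map `z ↦ Φ_{Re z + 2} (-2 + i Im z)` -/

section Straighten

variable {X : ℂ → ℂ} {K : ℝ≥0}

/-- Points with real part of size `≥ 1` or imaginary part of size `≥ 1` are off the open unit
disc. [folklore] -/
theorem one_le_norm_of_re_im {z : ℂ} (h : 1 ≤ |z.re| ∨ 1 ≤ |z.im|) : 1 ≤ ‖z‖ := by
  rcases h with h | h
  · exact h.trans (abs_re_le_norm z)
  · exact h.trans (abs_im_le_norm z)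

/-- The backward orbit of a point of the line `Re = -2` is the ray to its left. [folklore] -/
theorem globalFlow_base_neg (hK : LipschitzWith K X) (hB : ∀ z, ‖X z‖ ≤ 1)
    (hout : ∀ z, 1 ≤ ‖z‖ → X z = 1) (y u : ℝ) (hu : 0 ≤ u) :
    globalFlow hK hB (-2 + y * I) (-u) = -2 + y * I + ((-u : ℝ) : ℂ) := by
  refine globalFlow_eq_add_of_forall_one_le_norm' hK hB hout (by linarith) fun σ hσ => ?_
  refine one_le_norm_of_re_im (Or.inl ?_)
  have e : ((-2 : ℂ) + y * I + σ).re = -2 + σ := by simp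
  rw [e, abs_of_nonpos (by linarith [hσ.2])]
  linarith [hσ.2]

/-- **The straightening map is the identity on the rows `|Im z| ≥ 1`** (which lie off the disc).
[folklore] -/
theorem flowStraighten_eq_self_of_one_le_abs_im (hK : LipschitzWith K X) (hB : ∀ z, ‖X z‖ ≤ 1)
    (hout : ∀ z, 1 ≤ ‖z‖ → X z = 1) {z : ℂ} (hz : 1 ≤ |z.im|) :
    globalFlow hK hB (-2 + z.im * I) (z.re + 2) = z := by
  have hline : ∀ σ : ℝ, 1 ≤ ‖((-2 : ℂ) + z.im * I) + σ‖ := fun σ =>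
    one_le_norm_of_re_im (Or.inr (by simpa using hz))
  rcases le_or_gt 0 (z.re + 2) with h | h
  · rw [globalFlow_eq_add_of_forall_one_le_norm hK hB hout h fun σ _ => hline σ]
    apply Complex.ext <;> simp
  · rw [globalFlow_eq_add_of_forall_one_le_norm' hK hB hout h.le fun σ _ => hline σ]
    apply Complex.ext <;> simp

/-- **The straightening map is the identity on `{Re z ≤ -1}`** (the flow for time `Re z + 2 ≤ 1`
from the line `Re = -2` stays in `{Re ≤ -1}`, off the disc). [folklore] -/
theorem flowStraighten_eq_self_of_re_le (hK : LipschitzWith K X) (hB : ∀ z, ‖X z‖ ≤ 1)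
    (hout : ∀ z, 1 ≤ ‖z‖ → X z = 1) {z : ℂ} (hz : z.re ≤ -1) :
    globalFlow hK hB (-2 + z.im * I) (z.re + 2) = z := by
  have hre : ∀ σ : ℝ, (((-2 : ℂ) + z.im * I) + σ).re = -2 + σ := fun σ => by simp
  rcases le_or_gt 0 (z.re + 2) with h | h
  · rw [globalFlow_eq_add_of_forall_one_le_norm hK hB hout h fun σ hσ => ?_]
    · apply Complex.ext <;> simp
    · refine one_le_norm_of_re_im (Or.inl ?_)
      rw [hre, abs_of_nonpos (by linarith [hσ.2])]
      linarith [hσ.2]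
  · rw [globalFlow_eq_add_of_forall_one_le_norm' hK hB hout h.le fun σ hσ => ?_]
    · apply Complex.ext <;> simp
    · refine one_le_norm_of_re_im (Or.inl ?_)
      rw [hre, abs_of_nonpos (by linarith [hσ.2])]
      linarith [hσ.2]

/-- **The real part does not increase under the straightening map**: `Re Φ_{x+2}(-2 + iy) ≤ x`
(unit speed forward; straight backward). [folklore] -/
theorem re_flowStraighten_le (hK : LipschitzWith K X) (hB : ∀ z, ‖X z‖ ≤ 1)
    (hout : ∀ z, 1 ≤ ‖z‖ → X z = 1) (z : ℂ) :
    (globalFlow hK hB (-2 + z.im * I) (z.re + 2)).re ≤ z.re := by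
  rcases le_or_gt 0 (z.re + 2) with h | h
  · have := abs_re_globalFlow_sub_re_le hK hB (-2 + z.im * I) (z.re + 2)
    rw [abs_of_nonneg h] at this
    have h1 := (abs_le.1 this).2
    simp only [add_re, neg_re, re_ofNat, mul_re, ofReal_re, I_re, mul_zero, ofReal_im, I_im,
      mul_one, sub_self, add_zero] at h1
    linarith
  · have := globalFlow_base_neg hK hB hout z.im (-(z.re + 2)) (by linarith)
    rw [neg_neg] at this
    rw [this]
    simp

/-- **Translation equivariance far right**: if `Re` of the image is `≥ 1` (off the disc), flowing
`d ≥ 0` further just translates: `Φ_{x+d+2} p = Φ_{x+2} p + d`. [folklore] -/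
theorem flowStraighten_add_of_one_le_re (hK : LipschitzWith K X) (hB : ∀ z, ‖X z‖ ≤ 1)
    (hout : ∀ z, 1 ≤ ‖z‖ → X z = 1) {z : ℂ} (hz : 1 ≤ (globalFlow hK hB (-2 + z.im * I) (z.re + 2)).re)
    {d : ℝ} (hd : 0 ≤ d) :
    globalFlow hK hB (-2 + (z + d).im * I) ((z + d).re + 2) =
      globalFlow hK hB (-2 + z.im * I) (z.re + 2) + d := by
  have him : (z + (d : ℂ)).im = z.im := by simp
  have hre : (z + (d : ℂ)).re + 2 = (z.re + 2) + d := by simp; ring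
  rw [him, hre, globalFlow_add]
  refine globalFlow_eq_add_of_forall_one_le_norm hK hB hout hd fun σ hσ => ?_
  refine one_le_norm_of_re_im (Or.inl ?_)
  rw [add_re, ofReal_re, abs_of_pos (by linarith [hσ.1])]
  linarith [hσ.1]

/-- **The straightening map is injective** (two points of the line `Re = -2` on the same orbit
coincide, the backward orbit of such a point being the ray to its left). [folklore] -/
theorem injective_flowStraighten (hK : LipschitzWith K X) (hB : ∀ z, ‖X z‖ ≤ 1)
    (hout : ∀ z, 1 ≤ ‖z‖ → X z = 1) :
    Injective fun z : ℂ => globalFlow hK hB (-2 + z.im * I) (z.re + 2) := by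
  have key : ∀ (y y' d : ℝ), 0 ≤ d → globalFlow hK hB (-2 + y * I) d = -2 + y' * I → d = 0 ∧ y = y' := by
    intro y y' d hd h
    have h1 : (-2 + y * I : ℂ) = globalFlow hK hB (-2 + y' * I) (-d) := by
      rw [← h, globalFlow_neg_globalFlow]
    rw [globalFlow_base_neg hK hB hout y' d hd] at h1
    have hre := congrArg re h1
    have him := congrArg im h1
    simp at hre him
    exact ⟨by linarith, him⟩
  intro z z' h
  have hd : globalFlow hK hB (-2 + z.im * I) ((z.re + 2) + -(z'.re + 2)) = -2 + z'.im * I := by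
    have : globalFlow hK hB (globalFlow hK hB (-2 + z.im * I) (z.re + 2)) (-(z'.re + 2)) =
        globalFlow hK hB (globalFlow hK hB (-2 + z'.im * I) (z'.re + 2)) (-(z'.re + 2)) := by
      rw [show globalFlow hK hB (-2 + z.im * I) (z.re + 2) = globalFlow hK hB (-2 + z'.im * I) (z'.re + 2) from h]
    rwa [globalFlow_neg_globalFlow, ← globalFlow_add] at this
  rcases le_or_gt 0 ((z.re + 2) + -(z'.re + 2)) with hpos | hneg
  · obtain ⟨h1, h2⟩ := key _ _ _ hpos hd
    apply Complex.ext
    · linarith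
    · exact h2
  · have hd' : globalFlow hK hB (-2 + z'.im * I) ((z'.re + 2) + -(z.re + 2)) = -2 + z.im * I := by
      rw [← hd, ← globalFlow_add, show z.re + 2 + -(z'.re + 2) + (z'.re + 2 + -(z.re + 2)) = 0 by ring,
        globalFlow_zero]
    obtain ⟨h1, h2⟩ := key _ _ _ (by linarith) hd'
    apply Complex.ext
    · linarith
    · exact h2.symm

/-- **The straightening map is onto when backward semi-orbits are unbounded**: the backward orbit
of any point `w` crosses the line `Re = -2` (case analysis: `w` left of the line; a far backward
point left of the line and the intermediate value theorem; a far point on a row `|Im| ≥ 1`,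
whence straight motion; a far point right of the disc on a row `|Im| < 1` is impossible since
then `w`, further right on the same row, would be even farther). [folklore] -/
theorem surjective_flowStraighten (hK : LipschitzWith K X) (hB : ∀ z, ‖X z‖ ≤ 1)
    (hout : ∀ z, 1 ≤ ‖z‖ → X z = 1)
    (hesc : ∀ (w : ℂ) (R : ℝ), ∃ t : ℝ, t ≤ 0 ∧ R < ‖globalFlow hK hB w t‖) :
    Surjective fun z : ℂ => globalFlow hK hB (-2 + z.im * I) (z.re + 2) := by
  intro w
  -- it suffices that the orbit of `w` meets the line `Re = -2`
  suffices h : ∃ t : ℝ, (globalFlow hK hB w t).re = -2 by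
    obtain ⟨t, ht⟩ := h
    refine ⟨((-t - 2 : ℝ) : ℂ) + (globalFlow hK hB w t).im * I, ?_⟩
    have e : (-2 + ((globalFlow hK hB w t).im : ℂ) * I) = globalFlow hK hB w t := by
      apply Complex.ext <;> simp [ht]
    show globalFlow hK hB (-2 + ((((-t - 2 : ℝ) : ℂ) + (globalFlow hK hB w t).im * I).im : ℂ) * I)
      ((((-t - 2 : ℝ) : ℂ) + (globalFlow hK hB w t).im * I).re + 2) = w
    have e1 : ((((-t - 2 : ℝ) : ℂ) + (globalFlow hK hB w t).im * I).im : ℝ) = (globalFlow hK hB w t).im := by simp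
    have e2 : (((-t - 2 : ℝ) : ℂ) + (globalFlow hK hB w t).im * I).re + 2 = -t := by simp
    rw [e1, e2, e, ← globalFlow_add, add_neg_cancel, globalFlow_zero]
  by_cases hw : w.re < -2
  · -- forward straight motion from `w` reaches the line
    refine ⟨-2 - w.re, ?_⟩
    rw [globalFlow_eq_add_of_forall_one_le_norm hK hB hout (by linarith) fun σ hσ => ?_]
    · simp
    · refine one_le_norm_of_re_im (Or.inl ?_)
      rw [add_re, ofReal_re, abs_of_nonpos (by linarith [hσ.2])]
      linarith [hσ.2]
  · rw [not_lt] at hw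
    obtain ⟨t₀, ht₀, hfar⟩ := hesc w (max 3 (‖w‖ + 1))
    have hv3 : 3 < ‖globalFlow hK hB w t₀‖ := lt_of_le_of_lt (le_max_left _ _) hfar
    have hvw : ‖w‖ + 1 < ‖globalFlow hK hB w t₀‖ := lt_of_le_of_lt (le_max_right _ _) hfar
    by_cases hvre : (globalFlow hK hB w t₀).re ≤ -2
    · -- intermediate value theorem on `[t₀, 0]`
      have hcont : ContinuousOn (fun t => (globalFlow hK hB w t).re) (Icc t₀ 0) :=
        (continuous_re.comp (continuous_globalFlow hK hB w)).continuousOn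
      have hmem : (-2 : ℝ) ∈ Icc ((globalFlow hK hB w t₀).re) ((globalFlow hK hB w 0).re) :=
        ⟨hvre, by rw [globalFlow_zero]; exact hw⟩
      obtain ⟨t, -, ht⟩ := intermediate_value_Icc ht₀ hcont hmem
      exact ⟨t, ht⟩
    · rw [not_le] at hvre
      by_cases hvim : 1 ≤ |(globalFlow hK hB w t₀).im|
      · -- the row through the far point is off the disc: straight backward motion
        refine ⟨t₀ + -((globalFlow hK hB w t₀).re + 2), ?_⟩
        rw [globalFlow_add, globalFlow_eq_add_of_forall_one_le_norm' hK hB hout (by linarith) fun σ _ => ?_]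
        · simp
        · exact one_le_norm_of_re_im (Or.inr (by simpa using hvim))
      · -- impossible: the far point is right of the disc on the row of `w`
        exfalso
        rw [not_le] at hvim
        set v := globalFlow hK hB w t₀ with hv
        have hvre2 : 2 < v.re := by
          have h1 : ‖v‖ ≤ |v.re| + |v.im| := norm_le_abs_re_add_abs_im v
          have h2 : 2 < |v.re| := by linarith
          rcases abs_cases v.re with ⟨h3, -⟩ | ⟨h3, -⟩ <;> linarith
        have hwv : w = v + ((-t₀ : ℝ) : ℂ) := by
          have h1 : globalFlow hK hB v (-t₀) = w := by rw [hv, globalFlow_neg_globalFlow]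
          rw [← h1]
          refine globalFlow_eq_add_of_forall_one_le_norm hK hB hout (by linarith) fun σ hσ => ?_
          refine one_le_norm_of_re_im (Or.inl ?_)
          rw [add_re, ofReal_re, abs_of_pos (by linarith [hσ.1])]
          linarith [hσ.1]
        have hnorm : ‖v‖ ≤ ‖w‖ := by
          have hre' : (v + ((-t₀ : ℝ) : ℂ)).re = v.re + -t₀ := by simp
          have him' : (v + ((-t₀ : ℝ) : ℂ)).im = v.im := by simp
          have hsq : ‖v‖ ^ 2 ≤ ‖w‖ ^ 2 := by
            rw [Complex.sq_norm, Complex.sq_norm, Complex.normSq_apply, Complex.normSq_apply, hwv, hre', him']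
            nlinarith
          exact (pow_le_pow_iff_left₀ (norm_nonneg _) (norm_nonneg _) two_ne_zero).1 hsq
        linarith

/-- **The derivative of the straightening map** at `z` is the derivative `DΦ_t(p)` of the
time-`t` map at the base point (`t = Re z + 2`, `p = -2 + i Im z`): by the chain rule it is
`v ↦ DΦ_t(p) (Im v · i) + Re v · X (Φ_t p)`, and `X (Φ_t p) = DΦ_t(p) (X p) = DΦ_t(p) 1`
since `p` is off the disc. [folklore] -/
theorem hasFDerivAt_flowStraighten (hX : ContDiff ℝ 1 X) (hK : LipschitzWith K X)
    (hB : ∀ z, ‖X z‖ ≤ 1) (hout : ∀ z, 1 ≤ ‖z‖ → X z = 1) (z : ℂ) :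
    HasFDerivAt (fun z : ℂ => globalFlow hK hB (-2 + z.im * I) (z.re + 2))
      (fderiv ℝ (fun p : ℂ => globalFlow hK hB p (z.re + 2)) (-2 + z.im * I)) z := by
  set t : ℝ := z.re + 2 with ht_def
  set p : ℂ := -2 + z.im * I with hp_def
  set M := fderiv ℝ (fun p : ℂ => globalFlow hK hB p t) p with hM_def
  -- the joint flow map and its derivative at `(p, t)`
  have hJ : ContDiff ℝ 1 fun q : ℂ × ℝ => globalFlow hK hB q.1 q.2 := contDiff_globalFlow hX le_rfl hK hB
  set D := fderiv ℝ (fun q : ℂ × ℝ => globalFlow hK hB q.1 q.2) (p, t) with hD_def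
  have hD : HasFDerivAt (fun q : ℂ × ℝ => globalFlow hK hB q.1 q.2) D (p, t) :=
    (hJ.differentiable (by simp) _).hasFDerivAt
  -- partial derivative in the point
  have hD1 : ∀ v : ℂ, D (v, 0) = M v := by
    intro v
    have h1 : HasFDerivAt (fun q : ℂ => ((q, t) : ℂ × ℝ)) (ContinuousLinearMap.inl ℝ ℂ ℝ) p :=
      (hasFDerivAt_id p).prodMk (hasFDerivAt_const t p)
    have h2 := hD.comp p h1
    have h3 : HasFDerivAt (fun q : ℂ => globalFlow hK hB q t) M p := hasFDerivAt_globalFlow_apply hX hK hB t p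
    have h4 : D.comp (ContinuousLinearMap.inl ℝ ℂ ℝ) = M := h2.unique h3
    have := congrArg (fun f : ℂ →L[ℝ] ℂ => f v) h4
    simpa using this
  -- partial derivative in the time
  have hD2 : D ((0 : ℂ), (1 : ℝ)) = X (globalFlow hK hB p t) := by
    have h1 : HasDerivAt (fun s : ℝ => ((p, s) : ℂ × ℝ)) ((0 : ℂ), (1 : ℝ)) t :=
      (hasDerivAt_const t p).prodMk (hasDerivAt_id t)
    have h2 := hD.comp_hasDerivAt t h1
    have h3 : HasDerivAt (fun s : ℝ => globalFlow hK hB p s) (X (globalFlow hK hB p t)) t :=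
      hasDerivAt_globalFlow hK hB p t
    exact h2.unique h3
  -- `M 1 = X (Φ_t p)`
  have hXp : X p = 1 := hout p (one_le_norm_of_re_im (Or.inl (by simp [hp_def])))
  have hM1 : M 1 = X (globalFlow hK hB p t) := by
    rw [← hXp]; exact fderiv_globalFlow_apply_self hX hK hB t p
  -- the inner affine map `z ↦ (p z, t z)`
  have hinner : HasFDerivAt (fun z : ℂ => (((-2 : ℂ) + z.im • I, z.re + 2) : ℂ × ℝ))
      (((Complex.imCLM).smulRight I).prod Complex.reCLM) z := by
    refine HasFDerivAt.prodMk ?_ ?_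
    · exact (Complex.imCLM.hasFDerivAt.smul_const I).const_add (-2)
    · exact Complex.reCLM.hasFDerivAt.add_const 2
  have e0 : (((-2 : ℂ) + z.im • I, z.re + 2) : ℂ × ℝ) = (p, t) := by
    rw [hp_def, ht_def, Complex.real_smul]
  have hD' : HasFDerivAt (fun q : ℂ × ℝ => globalFlow hK hB q.1 q.2) D (((-2 : ℂ) + z.im • I, z.re + 2) : ℂ × ℝ) := by
    rw [e0]; exact hD
  have hcomp := hD'.comp z hinner
  have hfun : ((fun q : ℂ × ℝ => globalFlow hK hB q.1 q.2) ∘ fun z : ℂ => (((-2 : ℂ) + z.im • I, z.re + 2) : ℂ × ℝ)) =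
      fun z : ℂ => globalFlow hK hB (-2 + z.im * I) (z.re + 2) := by
    funext w
    simp only [comp_apply, Complex.real_smul]
  rw [hfun] at hcomp
  have hclm : D.comp (((Complex.imCLM).smulRight I).prod Complex.reCLM) = M := by
    ext1 v
    have e1 : ((((Complex.imCLM).smulRight I).prod Complex.reCLM) v : ℂ × ℝ) =
        ((v.im • I, (0 : ℝ)) : ℂ × ℝ) + v.re • (((0 : ℂ), (1 : ℝ)) : ℂ × ℝ) := by
      ext <;> simp
    rw [ContinuousLinearMap.comp_apply, e1, map_add, map_smul, hD1, hD2, ← hM1, ← map_smul, ← map_add]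
    congr 1
    rw [Complex.real_smul, Complex.real_smul, mul_one]
    conv_rhs => rw [← Complex.re_add_im v]
    ring
  rw [hclm] at hcomp
  exact hcomp

end Straighten

/-! ### Constant field: explicit flow -/

section ConstField

variable {X : ℂ → ℂ} {K : ℝ≥0}

/-- The flow of the constant field `1` is translation. [folklore] -/
theorem globalFlow_eq_add_of_forall_eq_one (hK : LipschitzWith K X) (hB : ∀ z, ‖X z‖ ≤ 1)
    (h1 : ∀ z, X z = 1) (z : ℂ) (t : ℝ) : globalFlow hK hB z t = z + t := by
  have ht : t ∈ Ioo (-(|t| + 1)) (|t| + 1) := by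
    constructor <;> cases abs_cases t <;> linarith
  have key := eqOn_globalFlow hK hB (γ := fun s : ℝ => z + s) (a := -(|t| + 1)) (b := |t| + 1)
    ⟨by linarith [abs_nonneg t], by linarith [abs_nonneg t]⟩ (fun s _ => by
      have h : HasDerivAt (fun s : ℝ => z + s) 1 s := by
        simpa using ((hasDerivAt_id s).ofReal_comp).const_add z
      rw [h1]; exact h)
  have := key ht
  simp only [ofReal_zero, add_zero] at this
  exact this.symm

end ConstField

/-! ### The family of fields `exp (χ(τ) Θ)` and the straightening isotopy -/

section Family

variable {Θ : ℂ → ℂ}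

/-- A smooth function vanishing off the closed unit disc has bounded derivative. [folklore] -/
theorem exists_bound_fderiv_of_eq_zero_off_disc (hΘ : ContDiff ℝ ∞ Θ)
    (hΘout : ∀ z, 1 ≤ ‖z‖ → Θ z = 0) : ∃ C : ℝ, 0 ≤ C ∧ ∀ z, ‖fderiv ℝ Θ z‖ ≤ C := by
  have hc : Continuous (fderiv ℝ Θ) := hΘ.continuous_fderiv (by simp)
  obtain ⟨C, hC⟩ := (isCompact_closedBall (0 : ℂ) 1).exists_bound_of_continuousOn hc.continuousOn
  have hC0 : 0 ≤ C := (norm_nonneg _).trans (hC 0 (mem_closedBall_self zero_le_one))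
  refine ⟨C, hC0, fun z => ?_⟩
  by_cases hz : ‖z‖ ≤ 1
  · exact hC z (mem_closedBall_zero_iff.2 hz)
  · -- off the closed disc `Θ` vanishes near `z`
    rw [not_le] at hz
    have hev : Θ =ᶠ[𝓝 z] fun _ => (0 : ℂ) := by
      have hopen : IsOpen {w : ℂ | 1 < ‖w‖} := isOpen_lt continuous_const continuous_norm
      filter_upwards [hopen.mem_nhds hz] with w hw
      exact hΘout w hw.le
    rw [hev.fderiv_eq, fderiv_const_apply, norm_zero]
    exact hC0

/-- A continuous function vanishing off the closed unit disc is bounded. [folklore] -/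
theorem exists_bound_of_eq_zero_off_disc (hΘ : Continuous Θ) (hΘout : ∀ z, 1 ≤ ‖z‖ → Θ z = 0) :
    ∃ C : ℝ, 0 ≤ C ∧ ∀ z, ‖Θ z‖ ≤ C := by
  obtain ⟨C, hC⟩ := (isCompact_closedBall (0 : ℂ) 1).exists_bound_of_continuousOn hΘ.continuousOn
  have hC0 : 0 ≤ C := (norm_nonneg _).trans (hC 0 (mem_closedBall_self zero_le_one))
  refine ⟨C, hC0, fun z => ?_⟩
  by_cases hz : ‖z‖ ≤ 1
  · exact hC z (mem_closedBall_zero_iff.2 hz)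
  · rw [hΘout z (le_of_lt (not_le.1 hz)), norm_zero]; exact hC0

/-- **The fields `X_τ = exp (χ(τ) Θ)`**: smooth, of unit norm (`Θ` purely imaginary), equal to `1`
off the disc, with a global logarithm, and uniformly Lipschitz. [folklore] -/
theorem field_family_props (hΘ : ContDiff ℝ ∞ Θ) (hΘout : ∀ z, 1 ≤ ‖z‖ → Θ z = 0)
    (hΘre : ∀ z, (Θ z).re = 0) :
    ∃ K : ℝ≥0,
      (∀ τ : ℝ, ContDiff ℝ ∞ fun z : ℂ => exp (((Real.smoothTransition τ : ℝ) : ℂ) * Θ z)) ∧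
      (∀ (τ : ℝ) (z : ℂ), ‖exp (((Real.smoothTransition τ : ℝ) : ℂ) * Θ z)‖ = 1) ∧
      (∀ (τ : ℝ) (z : ℂ), 1 ≤ ‖z‖ → exp (((Real.smoothTransition τ : ℝ) : ℂ) * Θ z) = 1) ∧
      (∀ τ : ℝ, LipschitzWith K fun z : ℂ => exp (((Real.smoothTransition τ : ℝ) : ℂ) * Θ z)) := by
  have hsmooth : ∀ τ : ℝ, ContDiff ℝ ∞ fun z : ℂ => exp (((Real.smoothTransition τ : ℝ) : ℂ) * Θ z) :=
    fun τ => ((Complex.contDiff_exp (𝕜 := ℂ)).restrict_scalars ℝ).comp (contDiff_const.mul hΘ)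
  have hnorm : ∀ (τ : ℝ) (z : ℂ), ‖exp (((Real.smoothTransition τ : ℝ) : ℂ) * Θ z)‖ = 1 := by
    intro τ z
    rw [Complex.norm_exp, mul_re, ofReal_re, ofReal_im, hΘre, mul_zero, zero_mul, sub_zero, Real.exp_zero]
  have hout : ∀ (τ : ℝ) (z : ℂ), 1 ≤ ‖z‖ → exp (((Real.smoothTransition τ : ℝ) : ℂ) * Θ z) = 1 := by
    intro τ z hz; rw [hΘout z hz, mul_zero, exp_zero]
  obtain ⟨C, hC0, hC⟩ := exists_bound_fderiv_of_eq_zero_off_disc hΘ hΘout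
  refine ⟨⟨C, hC0⟩, hsmooth, hnorm, hout, fun τ => ?_⟩
  have hd : ∀ z, HasFDerivAt (fun z : ℂ => exp (((Real.smoothTransition τ : ℝ) : ℂ) * Θ z))
      ((exp (((Real.smoothTransition τ : ℝ) : ℂ) * Θ z) • (1 : ℂ →L[ℝ] ℂ)).comp
        (((Real.smoothTransition τ : ℝ) : ℂ) • fderiv ℝ Θ z)) z := by
    intro z
    have h1 : HasFDerivAt (fun z : ℂ => ((Real.smoothTransition τ : ℝ) : ℂ) * Θ z)
        (((Real.smoothTransition τ : ℝ) : ℂ) • fderiv ℝ Θ z) z :=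
      ((hΘ.differentiable (by simp) z).hasFDerivAt).const_mul _
    exact (Complex.hasStrictFDerivAt_exp_real _).hasFDerivAt.comp z h1
  refine lipschitzWith_of_nnnorm_fderiv_le (fun z => (hd z).differentiableAt) fun z => ?_
  rw [(hd z).fderiv, ← NNReal.coe_le_coe, coe_nnnorm]
  change ‖(exp (((Real.smoothTransition τ : ℝ) : ℂ) * Θ z) • (1 : ℂ →L[ℝ] ℂ)).comp
    (((Real.smoothTransition τ : ℝ) : ℂ) • fderiv ℝ Θ z)‖ ≤ C
  refine (ContinuousLinearMap.opNorm_comp_le _ _).trans ?_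
  have h1 : ‖exp (((Real.smoothTransition τ : ℝ) : ℂ) * Θ z) • (1 : ℂ →L[ℝ] ℂ)‖ ≤ 1 := by
    rw [norm_smul, hnorm, one_mul]
    exact ContinuousLinearMap.norm_id_le
  have h2 : ‖((Real.smoothTransition τ : ℝ) : ℂ) • fderiv ℝ Θ z‖ ≤ C := by
    rw [norm_smul, norm_real, Real.norm_of_nonneg (Real.smoothTransition.nonneg τ)]
    calc Real.smoothTransition τ * ‖fderiv ℝ Θ z‖ ≤ 1 * ‖fderiv ℝ Θ z‖ :=
          mul_le_mul_of_nonneg_right (Real.smoothTransition.le_one τ) (norm_nonneg _)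
      _ ≤ C := by rw [one_mul]; exact hC z
  calc ‖exp (((Real.smoothTransition τ : ℝ) : ℂ) * Θ z) • (1 : ℂ →L[ℝ] ℂ)‖ *
        ‖((Real.smoothTransition τ : ℝ) : ℂ) • fderiv ℝ Θ z‖ ≤ 1 * C :=
        mul_le_mul h1 h2 (norm_nonneg _) zero_le_one
    _ = C := one_mul C

/-- **The suspended field `(z, τ) ↦ (X_τ z, 0)` on `ℂ × ℝ`** is smooth, bounded by `1` and
globally Lipschitz. [folklore] -/
theorem suspendedField_props (hΘ : ContDiff ℝ ∞ Θ) (hΘout : ∀ z, 1 ≤ ‖z‖ → Θ z = 0)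
    (hΘre : ∀ z, (Θ z).re = 0) {K : ℝ≥0}
    (hK : ∀ τ : ℝ, LipschitzWith K fun z : ℂ => exp (((Real.smoothTransition τ : ℝ) : ℂ) * Θ z)) :
    ∃ K' : ℝ≥0,
      ContDiff ℝ ∞ (fun q : ℂ × ℝ => ((exp (((Real.smoothTransition q.2 : ℝ) : ℂ) * Θ q.1), (0 : ℝ)) : ℂ × ℝ)) ∧
      (∀ q : ℂ × ℝ, ‖((exp (((Real.smoothTransition q.2 : ℝ) : ℂ) * Θ q.1), (0 : ℝ)) : ℂ × ℝ)‖ ≤ 1) ∧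
      LipschitzWith K' (fun q : ℂ × ℝ => ((exp (((Real.smoothTransition q.2 : ℝ) : ℂ) * Θ q.1), (0 : ℝ)) : ℂ × ℝ)) := by
  have hnorm : ∀ (τ : ℝ) (z : ℂ), ‖exp (((Real.smoothTransition τ : ℝ) : ℂ) * Θ z)‖ = 1 := by
    intro τ z
    rw [Complex.norm_exp, mul_re, ofReal_re, ofReal_im, hΘre, mul_zero, zero_mul, sub_zero, Real.exp_zero]
  have hsmooth : ContDiff ℝ ∞ (fun q : ℂ × ℝ => ((exp (((Real.smoothTransition q.2 : ℝ) : ℂ) * Θ q.1), (0 : ℝ)) : ℂ × ℝ)) := by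
    refine ContDiff.prodMk ?_ contDiff_const
    refine ((Complex.contDiff_exp (𝕜 := ℂ)).restrict_scalars ℝ).comp ?_
    exact ((ofRealCLM.contDiff.comp (Real.smoothTransition.contDiff.comp contDiff_snd)).mul
      (hΘ.comp contDiff_fst))
  have hbound : ∀ q : ℂ × ℝ, ‖((exp (((Real.smoothTransition q.2 : ℝ) : ℂ) * Θ q.1), (0 : ℝ)) : ℂ × ℝ)‖ ≤ 1 := by
    intro q
    rw [Prod.norm_mk, hnorm, norm_zero, max_eq_left zero_le_one]
  -- Lipschitz in `τ`: the derivative of `τ ↦ exp (χ τ Θ z)` is bounded by `C_χ ‖Θ‖_∞`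
  obtain ⟨-, -, Cχ, hCχ0, hCχ⟩ := deriv_smoothTransition_eq_zero
  obtain ⟨M, hM0, hM⟩ := exists_bound_of_eq_zero_off_disc hΘ.continuous hΘout
  have hτlip : ∀ (z : ℂ) (τ τ' : ℝ),
      ‖exp (((Real.smoothTransition τ' : ℝ) : ℂ) * Θ z) - exp (((Real.smoothTransition τ : ℝ) : ℂ) * Θ z)‖ ≤
        (Cχ * M) * ‖τ' - τ‖ := by
    intro z τ τ'
    have hd : ∀ σ : ℝ, HasDerivAt (fun σ : ℝ => exp (((Real.smoothTransition σ : ℝ) : ℂ) * Θ z))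
        (exp (((Real.smoothTransition σ : ℝ) : ℂ) * Θ z) * (((deriv Real.smoothTransition σ : ℝ) : ℂ) * Θ z)) σ := by
      intro σ
      have h1 : HasDerivAt (fun σ : ℝ => ((Real.smoothTransition σ : ℝ) : ℂ))
          ((deriv Real.smoothTransition σ : ℝ) : ℂ) σ :=
        ((Real.smoothTransition.contDiff (n := 1)).differentiable (by simp) σ).hasDerivAt.ofReal_comp
      exact (h1.mul_const (Θ z)).cexp
    refine (convex_univ (𝕜 := ℝ) (E := ℝ)).norm_image_sub_le_of_norm_hasDerivWithin_le
      (fun σ _ => (hd σ).hasDerivWithinAt) (fun σ _ => ?_) (mem_univ τ) (mem_univ τ')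
    rw [norm_mul, hnorm, one_mul, norm_mul, norm_real, Real.norm_eq_abs]
    exact mul_le_mul (hCχ σ) (hM z) (norm_nonneg _) hCχ0.le
  refine ⟨K + ⟨Cχ * M, by positivity⟩, hsmooth, hbound, LipschitzWith.of_dist_le_mul fun q q' => ?_⟩
  have e1 : dist ((exp (((Real.smoothTransition q.2 : ℝ) : ℂ) * Θ q.1), (0 : ℝ)) : ℂ × ℝ)
      ((exp (((Real.smoothTransition q'.2 : ℝ) : ℂ) * Θ q'.1), (0 : ℝ)) : ℂ × ℝ) =
        ‖exp (((Real.smoothTransition q.2 : ℝ) : ℂ) * Θ q.1) - exp (((Real.smoothTransition q'.2 : ℝ) : ℂ) * Θ q'.1)‖ := by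
    rw [dist_eq_norm, Prod.mk_sub_mk, sub_zero, Prod.norm_mk, norm_zero, max_eq_left (norm_nonneg _)]
  have e2 : ‖q.1 - q'.1‖ ≤ dist q q' := by
    rw [dist_eq_norm, ← Prod.fst_sub]; exact norm_fst_le (q - q')
  have e3 : ‖q.2 - q'.2‖ ≤ dist q q' := by
    rw [dist_eq_norm, ← Prod.snd_sub]; exact norm_snd_le (q - q')
  have hKnn : (0 : ℝ) ≤ K := K.2
  rw [e1]
  calc ‖exp (((Real.smoothTransition q.2 : ℝ) : ℂ) * Θ q.1) - exp (((Real.smoothTransition q'.2 : ℝ) : ℂ) * Θ q'.1)‖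
      ≤ ‖exp (((Real.smoothTransition q.2 : ℝ) : ℂ) * Θ q.1) - exp (((Real.smoothTransition q.2 : ℝ) : ℂ) * Θ q'.1)‖ +
        ‖exp (((Real.smoothTransition q.2 : ℝ) : ℂ) * Θ q'.1) - exp (((Real.smoothTransition q'.2 : ℝ) : ℂ) * Θ q'.1)‖ :=
        norm_sub_le_norm_sub_add_norm_sub _ _ _
    _ ≤ K * ‖q.1 - q'.1‖ + (Cχ * M) * ‖q.2 - q'.2‖ :=
        add_le_add ((hK q.2).norm_sub_le _ _) (hτlip q'.1 q'.2 q.2)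
    _ ≤ K * dist q q' + (Cχ * M) * dist q q' :=
        add_le_add (mul_le_mul_of_nonneg_left e2 hKnn) (mul_le_mul_of_nonneg_left e3 (by positivity))
    _ = ((K + ⟨Cχ * M, by positivity⟩ : ℝ≥0) : ℝ) * dist q q' := by
        rw [NNReal.coe_add]
        change _ = ((K : ℝ) + Cχ * M) * dist q q'
        ring

/-- **The straightening isotopy.** Let `Θ : ℂ → ℂ` be smooth, purely imaginary, and zero off the
closed unit disc, and let `X_τ = exp (χ(τ) Θ)` (`χ` the smooth transition, `X_0 = 1`,
`X_1 = exp Θ`). The maps `E_τ : x + iy ↦ Φ^{X_τ}_{x+2} (-2 + iy)` form an ambient isotopy of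
`ℂ` (smooth in `(τ, z)`, each stage a bijective local diffeomorphism, `E_0 = id`) which is the
identity on the rows `|Im| ≥ 1` and on `{Re ≤ -1}`, is translation equivariant to the right of
the disc, does not increase real parts, has `∂E_τ/∂x = 1` wherever `E_τ` is off the disc, and
whose final stage maps each line `Im = c` into the level set `{F = c}` of every first integral
`F` of `X_1` equal to `Im` off the disc. This is the re-integration step of Smale's proof of
Thm. B (with the Poincaré–Bendixson input `PlanarFlowEscape.lean` supplying surjectivity).
[cite: CerfDiffeoSphere1968, Appendice §5, Théorème 4] -/
theorem exists_ambientIsotopy_flowStraighten (hΘ : ContDiff ℝ ∞ Θ)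
    (hΘout : ∀ z, 1 ≤ ‖z‖ → Θ z = 0) (hΘre : ∀ z, (Θ z).re = 0) :
    ∃ A : AmbientIsotopy 𝓘(ℝ, ℂ) ℂ,
      (∀ (τ : ℝ) (z : ℂ), 1 ≤ |z.im| → A.toFun τ z = z) ∧
      (∀ (τ : ℝ) (z : ℂ), z.re ≤ -1 → A.toFun τ z = z) ∧
      (∀ (τ : ℝ) (z : ℂ) (d : ℝ), 0 ≤ d → 1 ≤ (A.toFun τ z).re → A.toFun τ (z + d) = A.toFun τ z + d) ∧
      (∀ (τ : ℝ) (z : ℂ), (A.toFun τ z).re ≤ z.re) ∧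
      (∀ (τ : ℝ) (z : ℂ), 1 ≤ ‖A.toFun τ z‖ → fderiv ℝ (A.toFun τ) z 1 = 1) ∧
      (∀ F : ℂ → ℝ, Differentiable ℝ F → (∀ z, fderiv ℝ F z (exp (Θ z)) = 0) →
        (∀ z, 1 ≤ ‖z‖ → F z = z.im) → ∀ z, F (A.toFun 1 z) = z.im) := by
  obtain ⟨K, hsmooth, hnorm, hout, hK⟩ := field_family_props hΘ hΘout hΘre
  have hB : ∀ (τ : ℝ) (z : ℂ), ‖exp (((Real.smoothTransition τ : ℝ) : ℂ) * Θ z)‖ ≤ 1 := fun τ z => (hnorm τ z).le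
  have hC1 : ∀ τ : ℝ, ContDiff ℝ 1 fun z : ℂ => exp (((Real.smoothTransition τ : ℝ) : ℂ) * Θ z) :=
    fun τ => (hsmooth τ).of_le (by simp)
  have hne : ∀ (τ : ℝ) (z : ℂ), exp (((Real.smoothTransition τ : ℝ) : ℂ) * Θ z) ≠ 0 := fun τ z => exp_ne_zero _
  have hlog : ∀ τ : ℝ, HasLogOn (fun z : ℂ => exp (((Real.smoothTransition τ : ℝ) : ℂ) * Θ z)) univ := fun τ =>
    ⟨fun z => ((Real.smoothTransition τ : ℝ) : ℂ) * Θ z, (continuous_const.mul hΘ.continuous).continuousOn,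
      fun z _ => rfl⟩
  -- the flows `Φ^τ` and backward escape
  have hesc : ∀ (τ : ℝ) (w : ℂ) (R : ℝ), ∃ t : ℝ, t ≤ 0 ∧ R < ‖globalFlow (hK τ) (hB τ) w t‖ := fun τ =>
    exists_lt_norm_globalFlow_of_nonpos (hC1 τ) (hK τ) (hB τ) (hne τ) (hlog τ)
  -- the suspended field and its flow
  obtain ⟨K', hYsmooth, hYbound, hYK⟩ := suspendedField_props hΘ hΘout hΘre hK
  have hΛ : ∀ (z : ℂ) (τ t : ℝ), globalFlow hYK hYbound (z, τ) t = (globalFlow (hK τ) (hB τ) z t, τ) := by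
    intro z τ t
    have ht : t ∈ Ioo (-(|t| + 1)) (|t| + 1) := by
      constructor <;> cases abs_cases t <;> linarith
    have key := eqOn_globalFlow hYK hYbound (γ := fun s : ℝ => ((globalFlow (hK τ) (hB τ) z s, τ) : ℂ × ℝ))
      (a := -(|t| + 1)) (b := |t| + 1) ⟨by linarith [abs_nonneg t], by linarith [abs_nonneg t]⟩
      (fun s _ => (hasDerivAt_globalFlow (hK τ) (hB τ) z s).prodMk (hasDerivAt_const s τ))
    have := key ht
    simp only [globalFlow_zero] at this
    exact this.symm
  have hΛsmooth : ContDiff ℝ ∞ fun q : (ℂ × ℝ) × ℝ => globalFlow hYK hYbound q.1 q.2 :=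
    contDiff_globalFlow hYsmooth (by simp) hYK hYbound
  -- joint smoothness of `(τ, z) ↦ E_τ z`
  have hjoint : ContDiff ℝ ∞ fun q : ℝ × ℂ =>
      globalFlow (hK q.1) (hB q.1) (-2 + (q.2.im : ℂ) * I) (q.2.re + 2) := by
    have hin : ContDiff ℝ ∞ fun q : ℝ × ℂ =>
        (((((-2 : ℂ) + (q.2.im : ℂ) * I, q.1) : ℂ × ℝ), q.2.re + 2) : (ℂ × ℝ) × ℝ) := by
      refine ContDiff.prodMk (ContDiff.prodMk ?_ contDiff_fst) ?_
      · exact contDiff_const.add ((ofRealCLM.contDiff.comp (Complex.imCLM.contDiff.comp contDiff_snd)).mul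
          contDiff_const)
      · exact (Complex.reCLM.contDiff.comp contDiff_snd).add contDiff_const
    have h1 : ContDiff ℝ ∞ fun q : ℝ × ℂ =>
        (globalFlow hYK hYbound (((-2 : ℂ) + (q.2.im : ℂ) * I, q.1) : ℂ × ℝ) (q.2.re + 2)).1 :=
      contDiff_fst.comp (hΛsmooth.comp hin)
    have e : (fun q : ℝ × ℂ => globalFlow (hK q.1) (hB q.1) (-2 + (q.2.im : ℂ) * I) (q.2.re + 2)) =
        fun q : ℝ × ℂ => (globalFlow hYK hYbound (((-2 : ℂ) + (q.2.im : ℂ) * I, q.1) : ℂ × ℝ) (q.2.re + 2)).1 := by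
      funext q; rw [hΛ]
    rw [e]; exact h1
  have hstage : ∀ τ : ℝ, ContDiff ℝ ∞ fun z : ℂ => globalFlow (hK τ) (hB τ) (-2 + (z.im : ℂ) * I) (z.re + 2) :=
    fun τ => hjoint.comp (contDiff_const.prodMk contDiff_id)
  -- the stage `0` is the identity
  have h0 : (fun z : ℂ => globalFlow (hK 0) (hB 0) (-2 + (z.im : ℂ) * I) (z.re + 2)) = id := by
    funext z
    have h1 : ∀ w : ℂ, exp (((Real.smoothTransition 0 : ℝ) : ℂ) * Θ w) = 1 := fun w => by
      rw [Real.smoothTransition.zero, ofReal_zero, zero_mul, exp_zero]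
    rw [globalFlow_eq_add_of_forall_eq_one (hK 0) (hB 0) h1]
    apply Complex.ext <;> simp
  -- the ambient isotopy
  set A : AmbientIsotopy 𝓘(ℝ, ℂ) ℂ :=
    { toFun := fun τ z => globalFlow (hK τ) (hB τ) (-2 + (z.im : ℂ) * I) (z.re + 2)
      contMDiff := contMDiff_prod_self_of_contDiff hjoint
      bijective := fun τ => ⟨injective_flowStraighten (hK τ) (hB τ) (hout τ),
        surjective_flowStraighten (hK τ) (hB τ) (hout τ) (hesc τ)⟩
      isLocalDiffeomorph := fun τ z => by
        obtain ⟨M, hM⟩ := exists_clEquiv_fderiv_globalFlow (hC1 τ) (hK τ) (hB τ) (z.re + 2) (-2 + z.im * I)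
        refine isLocalDiffeomorphAt_of_hasFDerivAt_writtenInExtChartAt (U := univ) isOpen_univ
          (mem_univ z) (hstage τ).contMDiff.contMDiffOn (by simp) M ?_
        rw [hM]
        exact hasFDerivAt_flowStraighten (hC1 τ) (hK τ) (hB τ) (hout τ) z
      map_zero := h0 } with hA
  refine ⟨A, fun τ z hz => ?_, fun τ z hz => ?_, fun τ z d hd hz => ?_, fun τ z => ?_, fun τ z hz => ?_,
    fun F hF hFX hFout z => ?_⟩
  · exact flowStraighten_eq_self_of_one_le_abs_im (hK τ) (hB τ) (hout τ) hz
  · exact flowStraighten_eq_self_of_re_le (hK τ) (hB τ) (hout τ) hz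
  · exact flowStraighten_add_of_one_le_re (hK τ) (hB τ) (hout τ) hz hd
  · exact re_flowStraighten_le (hK τ) (hB τ) (hout τ) z
  · -- `∂E_τ/∂x = DΦ_t(p) 1 = DΦ_t(p) (X_τ p) = X_τ (E_τ z) = 1`
    show fderiv ℝ (fun z : ℂ => globalFlow (hK τ) (hB τ) (-2 + (z.im : ℂ) * I) (z.re + 2)) z 1 = 1
    rw [(hasFDerivAt_flowStraighten (hC1 τ) (hK τ) (hB τ) (hout τ) z).fderiv]
    have hXp : exp (((Real.smoothTransition τ : ℝ) : ℂ) * Θ (-2 + z.im * I)) = 1 :=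
      hout τ _ (one_le_norm_of_re_im (Or.inl (by simp)))
    have := fderiv_globalFlow_apply_self (hC1 τ) (hK τ) (hB τ) (z.re + 2) (-2 + z.im * I)
    rw [hXp] at this
    rw [this]
    exact hout τ _ hz
  · -- `F` is constant along the flow of `X_1 = exp Θ`
    show F (globalFlow (hK 1) (hB 1) (-2 + (z.im : ℂ) * I) (z.re + 2)) = z.im
    have h1 : ∀ w : ℂ, exp (((Real.smoothTransition 1 : ℝ) : ℂ) * Θ w) = exp (Θ w) := fun w => by
      rw [Real.smoothTransition.one, ofReal_one, one_mul]
    have hconst : ∀ s : ℝ, F (globalFlow (hK 1) (hB 1) (-2 + (z.im : ℂ) * I) s) =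
        F (globalFlow (hK 1) (hB 1) (-2 + (z.im : ℂ) * I) 0) := by
      intro s
      have hd : ∀ s : ℝ, HasDerivAt (fun s : ℝ => F (globalFlow (hK 1) (hB 1) (-2 + (z.im : ℂ) * I) s))
          (fderiv ℝ F (globalFlow (hK 1) (hB 1) (-2 + (z.im : ℂ) * I) s)
            (exp (((Real.smoothTransition 1 : ℝ) : ℂ) * Θ (globalFlow (hK 1) (hB 1) (-2 + (z.im : ℂ) * I) s)))) s :=
        fun s => (hF _).hasFDerivAt.comp_hasDerivAt s (hasDerivAt_globalFlow (hK 1) (hB 1) _ s)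
      refine is_const_of_deriv_eq_zero (f := fun s : ℝ => F (globalFlow (hK 1) (hB 1) (-2 + (z.im : ℂ) * I) s))
        (fun s => (hd s).differentiableAt) (fun s => ?_) s 0
      rw [(hd s).deriv, h1]
      exact hFX _
    rw [hconst, globalFlow_zero, hFout _ (one_le_norm_of_re_im (Or.inl (by simp)))]
    simp

end Family

end Literature.Topology.FourManifolds
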